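import Literature.NumberTheory.QuadraticForms.HasseSymbolsRat
import Literature.NumberTheory.QuadraticForms.HilbertSymbolRegular
import Literature.NumberTheory.QuadraticForms.IsotropicRankFive
import Literature.NumberTheory.QuadraticForms.PadicSquares
import Literature.NumberTheory.QuadraticForms.HasseMinkowski
import Mathlib.NumberTheory.Padics.HeightOneSpectrum
import HarnessLib

/-!
# The Hilbert symbol of `ℚ_p` is bilinear and nondegenerate; forms of rank `≥ 5` over `ℚ_p`

Topic `NumberTheory/QuadraticForms`; namespace `Literature.NumberTheory.QuadraticForms`. Everything
here is proved, for Mathlib's `ℚ_[p]` and every prime `p`. Main result: the **discharge of the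
named fact `padic_representsZero_of_five_le`** (`HasseMinkowski.lean`; Serre, *A Course in
Arithmetic*, Ch. IV §2.2 Thm 6 (iv): every nondegenerate quadratic form of rank `≥ 5` over `ℚ_p`
represents `0`).

* `hilbertSymbol_padic_intCast` — for non-zero integers `a b` and every prime `p`,
  `(a, b)_{ℚ_p} = localSign p a b`, Serre's explicit value (Ch. III §1.2 Thm 1): the tree's
  evaluation at the place `v` of `ℚ` over `p` (`hilbertSymbol_rat_eq_localSign`, in
  `v.adicCompletion ℚ`) transported along Mathlib's `adicCompletion.padicEquiv`.
* `isRegularHilbertField_padic` — **Ch. III §1.2 Thm 2 for `k = ℚ_p`**: the Hilbert symbol of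
  `ℚ_p` is bilinear and nondegenerate (`IsRegularHilbertField ℚ_[p]`). Every square class of
  `ℚ_p^*` contains a non-zero integer (`padic_exists_intCast_mul_sq`), so bilinearity is that of
  the explicit signs (`localSignTwo_mul_left`, `localSignOdd_mul_left`), and for a non-square
  `b ~ p^e m` (`e ∈ {0,1}`, `p ∤ m`) an `a` with `(a, b)_p = -1` is read off Thm 1:
  `p` odd: `a = u` a non-residue if `e = 1`, `a = p` if `e = 0` (then `m` is a non-residue,
  units with square residue being squares, Ch. II §3.3 Thm 3); `p = 2`: `a = 5` if `e = 1`,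
  `a = 2` if `m ≡ 5 (mod 8)`, `a = -1` if `m ≡ 3, 7 (mod 8)` (`m ≡ 1 (mod 8)` being squares,
  Ch. II §3.3 Thm 4).
* `padic_exists_three_nonsquares` — `ℚ_p` has three elements `b, c, bc` none of which is a square
  (`u, p, up` for `p` odd; `2, 5, 10` for `p = 2`), witnessed by symbols `(a, ·)_p = -1`
  (Ch. II §3.3 Cor.: `ℚ_p^*/ℚ_p^{*2}` has order `4`, resp. `8`).
* `padic_representsZero_of_five_le_holds` — Thm 6 (iv), from `exists_isotropic_of_five_le`
  (`IsotropicRankFive.lean`).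

## References

* J.-P. Serre, *A Course in Arithmetic*, GTM 7, Springer 1973, Ch. II §3.3 (Thms 3, 4, Cor.),
  Ch. III §1.2 (Thms 1, 2), Ch. IV §2.2 Thm 6 (iv) (PDF pp. 17–20, 35–36). [Serre1973]
-/

noncomputable section

namespace Literature.NumberTheory.QuadraticForms

open ZMod IsDedekindDomain NumberField Rat.HeightOneSpectrum

/-! ### The explicit sign: bookkeeping -/

section LocalSign

variable {p : ℕ} [hp : Fact p.Prime]

omit hp in
/-- Bimultiplicativity of Serre's explicit local sign in the second variable (from
`localSign_mul_left`, `localSign_comm` of `HasseSymbolsRat.lean`; the same statement is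
`localSign_mul_right` of `HilbertSymbolPrescribedRat.lean`, not imported here to keep Dirichlet's
theorem out of the import closure). [cite: Serre1973, Ch. III §1.2 Thm 1] -/
theorem localSign_mul_right' {a b b' : ℤ} (ha : a ≠ 0) (hb : b ≠ 0) (hb' : b' ≠ 0) :
    localSign p a (b * b') = localSign p a b * localSign p a b' := by
  rw [localSign_comm p, localSign_mul_left p hb hb' ha, localSign_comm p b, localSign_comm p b']

/-- At an odd prime `p`: `(u, p)_p = (u / p)` for `p ∤ u`. [cite: Serre1973, Ch. III §1.2 Thm 1] -/
theorem localSign_odd_unit_prime (h2 : p ≠ 2) {u : ℤ} (hu : ¬ (p : ℤ) ∣ u) :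
    localSign p u p = legendreSym p u := by
  unfold localSign
  rw [if_neg h2]
  exact localSignOdd_self_right hu

/-- At an odd prime `p`: `(u, w)_p = 1` for `p ∤ u w`. [cite: Serre1973, Ch. III §1.2 Thm 1] -/
theorem localSign_odd_unit_unit (h2 : p ≠ 2) {u w : ℤ} (hu : ¬ (p : ℤ) ∣ u) (hw : ¬ (p : ℤ) ∣ w) :
    localSign p u w = 1 := by
  unfold localSign
  rw [if_neg h2]
  exact localSignOdd_of_not_dvd hu hw

omit hp in
/-- At `p = 2`: `(2, w)_2 = χ₈(w)` for `w` odd. [cite: Serre1973, Ch. III §1.2 Thm 1] -/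
theorem localSign_two_two_left (h2 : p = 2) {w : ℤ} (hw : ¬ (2 : ℤ) ∣ w) :
    localSign p 2 w = χ₈ (w : ZMod 8) := by
  unfold localSign
  rw [if_pos h2]
  exact localSignTwo_two_left hw

omit hp in
/-- At `p = 2`: `(u, w)_2 = (-1)^{ε(u)ε(w)}` for `u, w` odd. [cite: Serre1973, Ch. III §1.2 Thm 1] -/
theorem localSign_two_odd_odd (h2 : p = 2) {u w : ℤ} (hu : ¬ (2 : ℤ) ∣ u) (hw : ¬ (2 : ℤ) ∣ w) :
    localSign p u w = epsSign u w := by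
  unfold localSign
  rw [if_pos h2]
  exact localSignTwo_of_odd hu hw

end LocalSign

/-! ### The Hilbert symbol of `ℚ_p` on integers -/

/-- **Serre's Ch. III Thm 1 over Mathlib's `ℚ_[p]`**: for non-zero integers `a b` and the place
`v` of `ℚ` over `p = natGenerator v`, `(a, b)_{ℚ_p} = localSign p a b` — the evaluation
`hilbertSymbol_rat_eq_localSign` in `v.adicCompletion ℚ` transported along
`adicCompletion.padicEquiv v : ℚ_v ≃ ℚ_[p]`. [cite: Serre1973, Ch. III §1.2 Thm 1] -/
theorem hilbertSymbol_padic_natGenerator_intCast (v : HeightOneSpectrum (𝓞 ℚ)) {a b : ℤ}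
    (ha : a ≠ 0) (hb : b ≠ 0) :
    haveI : Fact (natGenerator v).Prime := ⟨prime_natGenerator v⟩
    hilbertSymbol ℚ_[natGenerator v] (a : ℚ_[natGenerator v]) (b : ℚ_[natGenerator v]) =
      localSign (natGenerator v) a b := by
  haveI : Fact (primesEquiv (R := 𝓞 ℚ) v : ℕ).Prime := ⟨(primesEquiv (R := 𝓞 ℚ) v).2⟩
  let e := (adicCompletion.padicEquiv (R := 𝓞 ℚ) v).toAlgEquiv
  rw [← hilbertSymbol_rat_eq_localSign v ha hb, ← hilbertSymbol_map_ringEquiv e.toRingEquiv]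
  have hea : ∀ q : ℚ, e.toRingEquiv (algebraMap ℚ (v.adicCompletion ℚ) q) =
      (q : ℚ_[primesEquiv v]) := by
    intro q
    change e (algebraMap ℚ (v.adicCompletion ℚ) q) = _
    rw [AlgEquiv.commutes, eq_ratCast]
  rw [hea, hea, Rat.cast_intCast, Rat.cast_intCast]
  rfl

/-- **`(a, b)_{ℚ_p} = localSign p a b`** for every prime `p` and non-zero integers `a b`
(Serre, Ch. III §1.2 Thm 1, over Mathlib's `ℚ_[p]`). [cite: Serre1973, Ch. III §1.2 Thm 1] -/
theorem hilbertSymbol_padic_intCast (p : ℕ) [Fact p.Prime] {a b : ℤ} (ha : a ≠ 0) (hb : b ≠ 0) :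
    hilbertSymbol ℚ_[p] (a : ℚ_[p]) (b : ℚ_[p]) = localSign p a b := by
  obtain ⟨v, hv⟩ : ∃ v : HeightOneSpectrum (𝓞 ℚ), natGenerator v = p :=
    ⟨(primesEquiv (R := 𝓞 ℚ)).symm ⟨p, Fact.out⟩,
      congrArg Subtype.val ((primesEquiv (R := 𝓞 ℚ)).apply_symm_apply ⟨p, Fact.out⟩)⟩
  subst hv
  exact hilbertSymbol_padic_natGenerator_intCast v ha hb

/-! ### Squares among integers in `ℚ_p` -/

section Squares

variable {p : ℕ} [hp : Fact p.Prime]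

/-- A symbol `(a, x)_F = -1` shows that `x ≠ 0` is not a square (`(a, s²) = 1`). [folklore] -/
theorem not_isSquare_of_hilbertSymbol_eq_neg_one {F : Type*} [Field F] {a x : F} (hx : x ≠ 0)
    (h : hilbertSymbol F a x = -1) : ¬ IsSquare x := fun hsq => by
  rw [hilbertSymbol_comm, hilbertSymbol_eq_one_of_isSquare hsq hx] at h
  norm_num at h

/-- Reduction of an integer to its square class: `n = (p^{α mod 2} u) · (p^{α/2})²` with
`u = primeCompl p n`. [folklore] -/
theorem intCast_eq_reduced_mul_sq (n : ℤ) :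
    (n : ℚ_[p]) = (((p : ℤ) ^ (padicValInt p n % 2) * primeCompl p n : ℤ) : ℚ_[p]) *
      ((p : ℚ_[p]) ^ (padicValInt p n / 2)) ^ 2 := by
  conv_lhs => rw [← pow_padicValInt_mul_primeCompl p n, ← Nat.div_add_mod (padicValInt p n) 2]
  push_cast
  ring

/-- **Odd `p`: a unit integer with square residue is a square in `ℚ_p`** (Serre, Ch. II §3.3
Thm 3): if `p ∤ m` and `m` is a square mod `p` then `m ∈ ℚ_p^{*2}`. [cite: Serre1973, Ch. II §3.3 Thm 3] -/
theorem padic_isSquare_intCast_of_isSquare_zmod (h2 : p ≠ 2) {m : ℤ} (hm : ¬ (p : ℤ) ∣ m)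
    (hsq : IsSquare (m : ZMod p)) : IsSquare (m : ℚ_[p]) := by
  obtain ⟨tbar, ht⟩ := hsq
  obtain ⟨t, rfl⟩ := ZMod.intCast_surjective tbar
  -- `t` is a unit mod `p` and in `ℤ_p`
  have hm0 : (m : ZMod p) ≠ 0 := by
    rwa [Ne, ZMod.intCast_zmod_eq_zero_iff_dvd]
  have ht0 : (t : ZMod p) ≠ 0 := fun h0 => hm0 (by rw [ht, h0, mul_zero])
  have htp : ¬ (p : ℤ) ∣ t := fun h => ht0 ((ZMod.intCast_zmod_eq_zero_iff_dvd t p).mpr h)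
  have hTu : IsUnit ((t : ℤ_[p])) := by
    rw [PadicInt.isUnit_iff]
    exact le_antisymm (PadicInt.norm_le_one _)
      (not_lt.mp (fun h => htp ((PadicInt.norm_int_lt_one_iff_dvd t).mp h)))
  obtain ⟨T, hT⟩ := hTu
  -- `w = m / t²` has residue `1`
  set w : ℤ_[p] := (m : ℤ_[p]) * ↑(T⁻¹ ^ 2) with hw
  have hwres : PadicInt.toZMod w = 1 := by
    have h1 : PadicInt.toZMod (T : ℤ_[p]) * PadicInt.toZMod (↑(T⁻¹) : ℤ_[p]) = 1 := by
      rw [← map_mul, Units.mul_inv, map_one]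
    have hTt : PadicInt.toZMod (T : ℤ_[p]) = (t : ZMod p) := by rw [hT, map_intCast]
    rw [hw, map_mul, Units.val_pow_eq_pow_val, map_pow, map_intCast, ht, ← hTt]
    linear_combination (PadicInt.toZMod (T : ℤ_[p]) * PadicInt.toZMod (↑(T⁻¹) : ℤ_[p]) + 1) * h1
  obtain ⟨s, hs⟩ := padicInt_isSquare_of_toZMod_eq_one h2 hwres
  -- `m = w t² = (s t)²`
  refine ⟨((s * T : ℤ_[p]) : ℚ_[p]), ?_⟩
  have hmw : (m : ℤ_[p]) = w * (T : ℤ_[p]) ^ 2 := by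
    rw [hw, Units.val_pow_eq_pow_val, mul_assoc, ← mul_pow, Units.inv_mul, one_pow, mul_one]
  have : ((m : ℤ_[p]) : ℚ_[p]) = (m : ℚ_[p]) := by simp
  rw [← this, hmw, hs]
  push_cast
  ring

/-- **`p = 2`: an integer `≡ 1 (mod 8)` is a square in `ℚ_2`** (Serre, Ch. II §3.3 Thm 4; the
tree's `Dyadic.exists_sq_eq_intCast_of_mod_eight`). [cite: Serre1973, Ch. II §3.3 Thm 4] -/
theorem padic_isSquare_intCast_of_mod_eight (h2 : p = 2) {m : ℤ} (hm : m % 8 = 1) :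
    IsSquare (m : ℚ_[p]) := by
  obtain ⟨z, -, hz⟩ := Dyadic.exists_sq_eq_intCast_of_mod_eight h2 hm
  exact ⟨(z : ℚ_[p]), by rw [← PadicInt.coe_mul, hz]; simp⟩

end Squares

/-! ### Bilinearity and nondegeneracy over `ℚ_p` -/

section Regular

variable (p : ℕ) [hp : Fact p.Prime]

/-- A quadratic non-residue modulo an odd prime `p`, as an integer prime to `p`. [folklore] -/
theorem exists_int_legendreSym_eq_neg_one (h2 : p ≠ 2) :
    ∃ u : ℤ, ¬ (p : ℤ) ∣ u ∧ legendreSym p u = -1 := by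
  have hchar : ringChar (ZMod p) ≠ 2 := by rw [ZMod.ringChar_zmod_n]; exact h2
  obtain ⟨abar, ha⟩ := FiniteField.exists_nonsquare hchar
  obtain ⟨u, rfl⟩ := ZMod.intCast_surjective abar
  have hu0 : (u : ZMod p) ≠ 0 := fun h0 => ha (h0 ▸ IsSquare.zero)
  refine ⟨u, fun h => hu0 ((ZMod.intCast_zmod_eq_zero_iff_dvd u p).mpr h), ?_⟩
  exact (legendreSym.eq_neg_one_iff p).mpr ha

/-- **Nondegeneracy of the Hilbert symbol of `ℚ_p` on reduced integers**: for `n = p^e m`,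
`e ∈ {0, 1}`, `p ∤ m`, `n ≠ 0`, either `n` is a square in `ℚ_p` or `(a, n)_p = -1` for some
non-zero integer `a` (read off Serre's Thm 1, Ch. III §1.2, with the square classes of Ch. II
§3.3). [cite: Serre1973, Ch. III §1.2 Thm 2] -/
theorem exists_localSign_eq_neg_one_or_isSquare (e : ℕ) (he : e < 2) {m : ℤ} (hm : ¬ (p : ℤ) ∣ m) :
    IsSquare ((((p : ℤ) ^ e * m : ℤ)) : ℚ_[p]) ∨
      ∃ a : ℤ, a ≠ 0 ∧ localSign p a ((p : ℤ) ^ e * m) = -1 := by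
  have hm0 : m ≠ 0 := fun h => hm (h ▸ dvd_zero _)
  have hp0 : (p : ℤ) ≠ 0 := by exact_mod_cast hp.out.ne_zero
  have hpp : ¬ (p : ℤ) ∣ (p : ℤ) → False := fun h => h dvd_rfl
  by_cases h2 : p = 2
  · -- `p = 2`
    have hm2 : ¬ (2 : ℤ) ∣ m := by rwa [h2] at hm
    have hmodd : Odd m := Int.not_even_iff_odd.mp (fun h => hm2 (even_iff_two_dvd.mp h))
    have hcast : ((p : ℕ) : ℤ) = 2 := by rw [h2]; rfl
    interval_cases e
    · -- `n = m` odd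
      simp only [pow_zero, one_mul]
      rcases Dyadic.mod_eight_of_odd hmodd with h8 | h8 | h8 | h8
      · exact Or.inl (padic_isSquare_intCast_of_mod_eight h2 h8)
      · refine Or.inr ⟨-1, by norm_num, ?_⟩
        rw [localSign_two_odd_odd h2 (by norm_num) hm2, epsSign_neg_one_left,
          Dyadic.zmod4_eq_of_mod h8]
        decide
      · refine Or.inr ⟨2, by norm_num, ?_⟩
        rw [localSign_two_two_left h2 hm2, Dyadic.zmod8_eq_of_mod h8]
        decide
      · refine Or.inr ⟨-1, by norm_num, ?_⟩
        rw [localSign_two_odd_odd h2 (by norm_num) hm2, epsSign_neg_one_left,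
          Dyadic.zmod4_eq_of_mod h8]
        decide
    · -- `n = 2 m`: `(5, 2m)_2 = χ₈(5) · (5, m)_2 = -1`
      refine Or.inr ⟨5, by norm_num, ?_⟩
      have h5 : ¬ (2 : ℤ) ∣ 5 := by norm_num
      rw [pow_one, hcast, localSign_mul_right' (by norm_num) two_ne_zero hm0,
        localSign_comm p, localSign_two_two_left h2 h5, localSign_two_odd_odd h2 h5 hm2]
      unfold epsSign
      have : χ₄ ((5 : ℤ) : ZMod 4) = 1 := by decide
      rw [this, if_neg (by rintro ⟨h, -⟩; norm_num at h), mul_one]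
      decide
  · -- `p` odd
    interval_cases e
    · -- `n = m`: square residue ⇒ square; otherwise `(p, m)_p = (m / p) = -1`
      simp only [pow_zero, one_mul]
      by_cases hsq : IsSquare (m : ZMod p)
      · exact Or.inl (padic_isSquare_intCast_of_isSquare_zmod h2 hm hsq)
      · refine Or.inr ⟨p, hp0, ?_⟩
        rw [localSign_comm p, localSign_odd_unit_prime h2 hm]
        exact (legendreSym.eq_neg_one_iff p).mpr hsq
    · -- `n = p m`: `(u, p m)_p = (u / p) = -1` for a non-residue `u`
      obtain ⟨u, hu, hleg⟩ := exists_int_legendreSym_eq_neg_one p h2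
      have hu0 : u ≠ 0 := fun h => hu (h ▸ dvd_zero _)
      refine Or.inr ⟨u, hu0, ?_⟩
      rw [pow_one, localSign_mul_right' hu0 hp0 hm0, localSign_odd_unit_prime h2 hu,
        localSign_odd_unit_unit h2 hu hm, hleg]
      norm_num

/-- **The Hilbert symbol of `ℚ_p` is bilinear and nondegenerate** (Serre, *A Course in
Arithmetic*, Ch. III §1.2 Thm 2: "The Hilbert symbol is a nondegenerate bilinear form on the
`𝔽₂`-vector space `k^*/k^{*2}`", `k = ℚ_p`), for Mathlib's `ℚ_[p]`, every prime `p`: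
`IsRegularHilbertField ℚ_[p]`. Bilinearity: integer representatives of square classes
(`padic_exists_intCast_mul_sq`) and the bimultiplicativity of the explicit signs of Thm 1;
nondegeneracy: `exists_localSign_eq_neg_one_or_isSquare`. [cite: Serre1973, Ch. III §1.2 Thm 2] -/
theorem isRegularHilbertField_padic : IsRegularHilbertField ℚ_[p] where
  two_ne_zero := two_ne_zero
  mul_left := by
    intro x y z hx hy hz
    obtain ⟨n₁, s₁, hn₁, hs₁, rfl⟩ := padic_exists_intCast_mul_sq x hx
    obtain ⟨n₂, s₂, hn₂, hs₂, rfl⟩ := padic_exists_intCast_mul_sq y hy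
    obtain ⟨m, t, hm, ht, rfl⟩ := padic_exists_intCast_mul_sq z hz
    have hxy : (n₁ : ℚ_[p]) * s₁ ^ 2 * ((n₂ : ℚ_[p]) * s₂ ^ 2) =
        ((n₁ * n₂ : ℤ) : ℚ_[p]) * (s₁ * s₂) ^ 2 := by push_cast; ring
    rw [hxy, hilbertSymbol_mul_sq_left _ _ (mul_ne_zero hs₁ hs₂), hilbertSymbol_mul_sq_right _ _ ht,
      hilbertSymbol_mul_sq_left _ _ hs₁, hilbertSymbol_mul_sq_right _ _ ht,
      hilbertSymbol_mul_sq_left _ _ hs₂, hilbertSymbol_mul_sq_right _ _ ht,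
      hilbertSymbol_padic_intCast p (mul_ne_zero hn₁ hn₂) hm, hilbertSymbol_padic_intCast p hn₁ hm,
      hilbertSymbol_padic_intCast p hn₂ hm, localSign_mul_left p hn₁ hn₂ hm]
  exists_eq_neg_one := by
    intro b hb hbsq
    obtain ⟨n, s, hn, hs, rfl⟩ := padic_exists_intCast_mul_sq b hb
    -- reduce `n` to `p^e m`, `e = v_p(n) mod 2`
    have hred := intCast_eq_reduced_mul_sq (p := p) n
    set e := padicValInt p n % 2 with he
    set m := primeCompl p n with hmdef
    have hm : ¬ (p : ℤ) ∣ m := not_dvd_primeCompl hn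
    have hpk : ((p : ℚ_[p]) ^ (padicValInt p n / 2)) ≠ 0 :=
      pow_ne_zero _ (by exact_mod_cast hp.out.ne_zero)
    rcases exists_localSign_eq_neg_one_or_isSquare p e (Nat.mod_lt _ (by norm_num)) hm with
      hsq | ⟨a, ha0, ha⟩
    · -- then `b` would be a square
      exfalso
      apply hbsq
      obtain ⟨r, hr⟩ := hsq
      refine ⟨r * (p : ℚ_[p]) ^ (padicValInt p n / 2) * s, ?_⟩
      rw [hred, hr]
      ring
    · refine ⟨a, by exact_mod_cast ha0, ?_⟩
      have hne : (((p : ℤ) ^ e * m : ℤ)) ≠ 0 :=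
        mul_ne_zero (pow_ne_zero _ (by exact_mod_cast hp.out.ne_zero)) (fun h => hm (h ▸ dvd_zero _))
      rw [hilbertSymbol_mul_sq_right _ _ hs, hred, hilbertSymbol_mul_sq_right _ _ hpk,
        hilbertSymbol_padic_intCast p ha0 hne, ha]

/-- **Three non-squares `b, c, bc` in `ℚ_p`** (so `ℚ_p^*/ℚ_p^{*2}` has order `≥ 4`; Serre,
*A Course in Arithmetic*, Ch. II §3.3 Cor.: order `4` for `p ≠ 2`, `8` for `p = 2`): `u, p, up`
for `p` odd (`u` a non-residue), `2, 5, 10` for `p = 2`, each witnessed by a Hilbert symbol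
`(a, ·)_p = -1`. [cite: Serre1973, Ch. II §3.3 Cor.] -/
theorem padic_exists_three_nonsquares :
    ∃ b c : ℚ_[p], ¬ IsSquare b ∧ ¬ IsSquare c ∧ ¬ IsSquare (b * c) := by
  have hp0 : (p : ℤ) ≠ 0 := by exact_mod_cast hp.out.ne_zero
  have hp0' : (p : ℚ_[p]) ≠ 0 := by exact_mod_cast hp.out.ne_zero
  by_cases h2 : p = 2
  · have h5 : ¬ (2 : ℤ) ∣ 5 := by norm_num
    have hs25 : localSign p 5 2 = -1 := by
      rw [localSign_comm p, localSign_two_two_left h2 h5]; decide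
    have hs52 : localSign p 2 5 = -1 := by
      rw [localSign_two_two_left h2 h5]; decide
    have hs510 : localSign p 5 10 = -1 := by
      rw [show (10 : ℤ) = 2 * 5 by norm_num, localSign_mul_right' (by norm_num) (by norm_num)
        (by norm_num), localSign_comm p 5 2, localSign_two_two_left h2 h5,
        localSign_two_odd_odd h2 h5 h5]
      unfold epsSign
      have : χ₄ ((5 : ℤ) : ZMod 4) = 1 := by decide
      rw [this]; decide
    refine ⟨2, 5, ?_, ?_, ?_⟩
    · refine not_isSquare_of_hilbertSymbol_eq_neg_one (a := ((5 : ℤ) : ℚ_[p])) two_ne_zero ?_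
      have := hilbertSymbol_padic_intCast p (a := 5) (b := 2) (by norm_num) (by norm_num)
      push_cast at this ⊢
      rw [this, hs25]
    · refine not_isSquare_of_hilbertSymbol_eq_neg_one (a := ((2 : ℤ) : ℚ_[p])) (by norm_num) ?_
      have := hilbertSymbol_padic_intCast p (a := 2) (b := 5) (by norm_num) (by norm_num)
      push_cast at this ⊢
      rw [this, hs52]
    · refine not_isSquare_of_hilbertSymbol_eq_neg_one (a := ((5 : ℤ) : ℚ_[p])) (by norm_num) ?_
      have := hilbertSymbol_padic_intCast p (a := 5) (b := 10) (by norm_num) (by norm_num)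
      push_cast at this ⊢
      rw [show (2 : ℚ_[p]) * 5 = 10 by norm_num, this, hs510]
  · obtain ⟨u, hu, hleg⟩ := exists_int_legendreSym_eq_neg_one p h2
    have hu0 : u ≠ 0 := fun h => hu (h ▸ dvd_zero _)
    have hu0' : (u : ℚ_[p]) ≠ 0 := by exact_mod_cast hu0
    have hpp : ¬ (p : ℤ) ∣ u := hu
    refine ⟨u, p, ?_, ?_, ?_⟩
    · -- `(p, u)_p = (u / p) = -1`
      refine not_isSquare_of_hilbertSymbol_eq_neg_one (a := ((p : ℤ) : ℚ_[p])) hu0' ?_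
      rw [hilbertSymbol_padic_intCast p hp0 hu0, localSign_comm p, localSign_odd_unit_prime h2 hu, hleg]
    · -- `(u, p)_p = -1`
      refine not_isSquare_of_hilbertSymbol_eq_neg_one (a := ((u : ℤ) : ℚ_[p])) hp0' ?_
      have := hilbertSymbol_padic_intCast p (a := u) (b := p) hu0 hp0
      push_cast at this
      rw [this, localSign_odd_unit_prime h2 hu, hleg]
    · -- `(u, u p)_p = (u, u)_p (u, p)_p = -1`
      refine not_isSquare_of_hilbertSymbol_eq_neg_one (a := ((u : ℤ) : ℚ_[p]))
        (mul_ne_zero hu0' hp0') ?_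
      have := hilbertSymbol_padic_intCast p (a := u) (b := u * p) hu0 (mul_ne_zero hu0 hp0)
      push_cast at this
      rw [this, localSign_mul_right' hu0 hu0 hp0, localSign_odd_unit_unit h2 hu hu,
        localSign_odd_unit_prime h2 hu, hleg]
      norm_num

end Regular

/-! ### Theorem 6 (iv) over `ℚ_p` -/

/-- **Discharge of `padic_representsZero_of_five_le`** (Serre, *A Course in Arithmetic*, Ch. IV
§2.2 Thm 6 (iv)): for every prime `p`, every symmetric `A ∈ Mₙ(ℚ_p)` with `n ≥ 5` and
`det A ≠ 0` represents zero — `exists_isotropic_of_five_le` for the field `ℚ_[p]`, whose Hilbert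
symbol is bilinear and nondegenerate (`isRegularHilbertField_padic`) and which has three
non-squares `b, c, bc` (`padic_exists_three_nonsquares`). [cite: Serre1973, Ch. IV §2.2 Thm 6 (iv)] -/
theorem padic_representsZero_of_five_le_holds : padic_representsZero_of_five_le := by
  intro p _ n A hn hA hdet
  exact exists_isotropic_of_five_le (isRegularHilbertField_padic p)
    (padic_exists_three_nonsquares p) A hn hA hdet

end Literature.NumberTheory.QuadraticForms
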